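import Mathlib.Topology.Algebra.Polynomial
import Mathlib.Algebra.Polynomial.Div
import Mathlib.Algebra.Polynomial.Inductions
import Literature.Computability.AlgebraicComplexity.BorderRankCWThm42
import Literature.Computability.AlgebraicComplexity.BorderRankCWDet3Seventeen
import HarnessLib

/-!
# CGLV Thm. 4.2 (`bR_S(det₃) ≤ 17`) and Thm. 1.3 discharged: a kernel certificate

Topic `Literature/Computability/AlgebraicComplexity`; sibling of `BorderRankCW.lean`
(Conner–Gesmundo–Landsberg–Ventura, *Rank and border rank of Kronecker powers of tensors and
Strassen's laser method*, comput. complexity 31 (2022) = arXiv:1909.04785v2; numbering of v2, as in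
the sibling files: Thm. 1.3 = Thm. 4.1 ∧ Thm. 4.2; in the journal version these are Thms. 2.11, 2.12
and §5). This file proves the two remaining named facts about `det₃` of that cluster:

* `CGLV2022_thm42_holds : CGLV2022_thm42` — `bR_S(det₃) ≤ 17` (`BorderRankCWProofs.lean`);
* `CGLV2022_thm13_holds : CGLV2022_thm13` — `R_S(det₃) ≤ 18 ∧ bR_S(det₃) ≤ 17` (`BorderRankCW.lean`),
  from Thm. 4.1 (`waringRank_det3Tensor_le`, proved in `BorderRankCWProofs.lean`) and the above.

## The certificate

CGLV prove Thm. 4.2 by a computer-assisted certificate whose 44 parameters are real algebraic numbers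
of degree 81 (§4 of v2 = §5.2 of the journal version; vendored in `BorderRankCWThm42.lean`, where the
border-rank half of that proof is proved and the existence of the algebraic solution is the named
fact `CGLV2022_br17RealSolution`). The bound itself has a much smaller certificate:
Conner–Huang–Landsberg, *Bad and good news for Strassen's laser method*, arXiv:2009.11391, §8
("A simpler Waring border rank 17 expression for det₃ … than the one in [CGLV]") print 17
matrices `m_s(t) ∈ ℂ[t, t⁻¹]^{3×3}` with monomial entries over
`ℤ[1/10][ζ₁₂, 5^{1/6}]` such that `det₃ = ∑_{s=1}^{17} m_s(t)^{⊗3} + O(t)` — a *symmetric* (Waring)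
approximate decomposition. `BorderRankCWDet3Seventeen.lean` already has the KERNEL verify this
identity (`CHL17.checkAll_eq_true`, `decide +kernel`, in the exact model `CHL17.Z12S` of
`ℤ[ζ₁₂][5^{1/6}]`, for `M_s := 10 t⁵ m_s(t)`: `∑_s M_s^{⊗3} ≡ 1000 t¹⁵ (ε ⊗ ε) (mod t¹⁶)`), but in the
signed relabelling `T_{skewcw,2}(i,j,k) = s_b(j) s_c(k) ε_{i j γ(k)}` adapted to
`T_{skewcw,2}^{⊠2} ≅ det₃` (it is used there for `bR(T_{skewcw,2}^{⊠2}) ≤ 17`). Here: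

* `mem_closure_waringLESet_of_isApproxDecomposition` — over `ℂ`, a symmetric approximate
  decomposition `∑_{ρ<r} u_ρ(t)^{⊗3} = t^h T + O(t^{h+1})` puts `T` in the closure of the sums of `r`
  cubes (for `t ≠ 0`, `t^{-h} ∑_ρ u_ρ(t)^{⊗3} = T + t·F(t)` is a sum of `r` cubes since that set is a
  cone, `smul_mem_waringLESet`; let `t → 0`), i.e. `bR_S(T) ≤ r` — the standard argument, as in the
  definition of `bR_S` (CGLV §4 / journal §2.3);
* `CHL17.sign_untwist` — the 3⁶-case sign identity undoing the relabelling (`decide`);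
  `CHL17.isApproxDecomposition_untwist`, `CHL17.exists_isApproxDecomposition_det3Target` — the
  kernel-verified identity read as `IsApproxDecomposition 15 (1000 · ε ⊗ ε) M M M` for the untwisted
  vectors `M_s ∈ ℂ[t]^{3×3}` (kept definition-free: `M` is pinned down by a hypothesis `hu`);
* `det3Target_mem_closure_waringLESet`, `CGLV2022_thm42_holds` (`det₃ = (1/6) ε ⊗ ε`, cone again),
  `CGLV2022_thm13_holds`.

No definitions and no new facts (theorems only); axioms are the standard three.

## References

* A. Conner, F. Gesmundo, J. M. Landsberg, E. Ventura, *Rank and border rank of Kronecker powers of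
  tensors and Strassen's laser method*, comput. complexity 31 (2022) = arXiv:1909.04785v2, Thm. 1.3,
  §4: Thm. 4.1, Thm. 4.2 (journal: Thm. 2.11, Thm. 2.12, §5). [ConnerGesmundoLandsbergVentura2022]
* A. Conner, H. Huang, J. M. Landsberg, *Bad and good news for Strassen's laser method: border rank of
  perm₃ and strict submultiplicativity*, Found. Comput. Math. (2022) = arXiv:2009.11391, §8 (the 17
  matrices `m_s(t)`, "det₃ = ∑_{s=1}^{17} m_s³(t) + O(t)"). [ConnerHuangLandsberg2020]
-/

noncomputable section

open scoped BigOperators Polynomial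
open Filter Polynomial
open _root_.Topology

namespace Literature.Computability.AlgebraicComplexity

/-! ## Symmetric approximate decompositions bound the border Waring rank -/

/-- **A symmetric approximate decomposition bounds the border Waring rank** (over `ℂ`): if
`∑_{ρ<r} u_ρ(t) ⊗ u_ρ(t) ⊗ u_ρ(t) = t^h T + O(t^{h+1})` in `ℂ[t]`, then `T` lies in the closure of
the set of sums of `r` cubes, i.e. `bR_S(T) ≤ r`. For `t ≠ 0`, `t^{-h} ∑_ρ u_ρ(t)^{⊗3} = T + t F(t)`
(with `F` polynomial in `t`) is again a sum of `r` cubes (`smul_mem_waringLESet`), and `t → 0`.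
[cite: ConnerGesmundoLandsbergVentura2022, §4 (definition of bR_S)] -/
theorem mem_closure_waringLESet_of_isApproxDecomposition {ι : Type*} {h r : ℕ}
    {T : ι → ι → ι → ℂ} {u : Fin r → ι → ℂ[X]} (hu : IsApproxDecomposition h T u u u) :
    T ∈ closure (waringLESet ι ℂ r) := by
  -- the entries of `∑_ρ u_ρ ⊗ u_ρ ⊗ u_ρ` are divisible by `t^h` …
  have hdvd : ∀ a b c, ∃ Q : ℂ[X], (∑ ρ, u ρ a * u ρ b * u ρ c) = X ^ h * Q := fun a b c =>
    X_pow_dvd_iff.2 fun d hd => by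
      have e := hu a b c d hd.le
      rwa [if_neg hd.ne] at e
  choose Q hQ using hdvd
  -- … with quotient `Q = T + t · divX Q`
  have hQ0 : ∀ a b c, (Q a b c).coeff 0 = T a b c := by
    intro a b c
    have e := hu a b c h le_rfl
    rw [if_pos rfl, hQ a b c, coeff_X_pow_mul', if_pos le_rfl, Nat.sub_self] at e
    exact e
  set F : ℂ → ι → ι → ι → ℂ := fun t a b c => T a b c + t * (divX (Q a b c)).eval t with hF
  have heval : ∀ t a b c, (∑ ρ, u ρ a * u ρ b * u ρ c).eval t = t ^ h * F t a b c := by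
    intro t a b c
    rw [hQ a b c, eval_mul, eval_pow, eval_X]
    congr 1
    conv_lhs => rw [← X_mul_divX_add (Q a b c)]
    rw [eval_add, eval_mul, eval_X, eval_C, hQ0]
    ring
  have hmem : ∀ t : ℂ, t ≠ 0 → F t ∈ waringLESet ι ℂ r := by
    intro t ht
    obtain ⟨s, hs⟩ : ∃ s : ℂ, s ^ 3 = (t ^ h)⁻¹ := IsAlgClosed.exists_pow_nat_eq _ (by norm_num)
    refine ⟨fun ρ a => s * (u ρ a).eval t, ?_⟩
    funext a b c
    simp only [Finset.sum_apply, triad_apply]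
    have hth : t ^ h ≠ 0 := pow_ne_zero h ht
    calc F t a b c = s ^ 3 * (t ^ h * F t a b c) := by
          rw [hs, ← mul_assoc, inv_mul_cancel₀ hth, one_mul]
      _ = s ^ 3 * (∑ ρ, u ρ a * u ρ b * u ρ c).eval t := by rw [heval]
      _ = s ^ 3 * ∑ ρ, (u ρ a).eval t * (u ρ b).eval t * (u ρ c).eval t := by
          simp only [eval_finsetSum, eval_mul]
      _ = ∑ ρ, s * (u ρ a).eval t * (s * (u ρ b).eval t) * (s * (u ρ c).eval t) := by
          rw [Finset.mul_sum]
          exact Finset.sum_congr rfl fun ρ _ => by ring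
  have hcont : Continuous F :=
    continuous_pi fun a => continuous_pi fun b => continuous_pi fun c =>
      continuous_const.add (continuous_id.mul (Polynomial.continuous _))
  have hF0 : F 0 = T := by
    funext a b c
    simp [hF]
  have hlim : Tendsto F (𝓝[≠] 0) (𝓝 T) := by
    have h0 := hcont.tendsto 0
    rw [hF0] at h0
    exact tendsto_nhdsWithin_of_tendsto_nhds h0
  exact mem_closure_of_tendsto hlim (eventually_nhdsWithin_of_forall fun t ht => hmem t ht)

/-- Hence a symmetric approximate decomposition with `r` vectors gives `bR_S(T) ≤ r`.
[cite: ConnerGesmundoLandsbergVentura2022, §4 (definition of bR_S)] -/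
theorem borderWaringRank_le_of_isApproxDecomposition {ι : Type*} {h r : ℕ}
    {T : ι → ι → ι → ℂ} {u : Fin r → ι → ℂ[X]} (hu : IsApproxDecomposition h T u u u) :
    borderWaringRank T ≤ r :=
  Nat.sInf_le (mem_closure_waringLESet_of_isApproxDecomposition hu)

/-! ## Untwisting the kernel-verified identity of CHL 2020, §8 -/

namespace CHL17

/-- `γ = (1 2)` is an involution. [folklore] -/
theorem gam_gam (k : Fin 3) : gam (gam k) = k := by
  revert k
  decide

/-- **The relabelling undone**: with `σ = s_b(j) s_b(m) s_c(γk) s_c(γn)`,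
`σ · T_{skewcw,2}(i,j,γk) T_{skewcw,2}(l,m,γn) = ε_{ijk} ε_{lmn}` (all `3⁶` cases, from
`T_{skewcw,2}(i,j,k) = s_b(j) s_c(k) ε_{i j γ(k)}`). [cite: ConnerGesmundoLandsbergVentura2022, Lemma 2.4 (proof, §3.2)] -/
theorem sign_untwist (i l j m k n : Fin 3) :
    sgnB j * sgnB m * (sgnC (gam k) * sgnC (gam n)) * (skewZ i j (gam k) * skewZ l m (gam n)) =
      leviCivita3Table i j k * leviCivita3Table l m n := by
  revert i l j m k n
  decide

/-- The sign `σ` squares to `1`. [folklore] -/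
theorem sign_sq (j m k n : Fin 3) :
    (sgnB j * sgnB m * (sgnC (gam k) * sgnC (gam n))) *
      (sgnB j * sgnB m * (sgnC (gam k) * sgnC (gam n))) = 1 := by
  revert j m k n
  decide

section Untwist

/-! Throughout, `u` is the family of **untwisted vectors `M_s = 10 t⁵ m_s(t) ∈ ℂ[t]^{3×3}`** of
CHL 2020, §8 (index `a = (row, column)`, entry `ev(c) · t^e` for the tabulated monomial `(c, e)` of
`chlTable`), specified by the hypothesis `hu` rather than by a definition. -/

variable {u : Fin 17 → Fin 3 × Fin 3 → ℂ[X]}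
  (hu : ∀ ρ a, u ρ a = C (ev (mEntry (chlTable ρ) a.1 a.2).1) * X ^ (mEntry (chlTable ρ) a.1 a.2).2)
include hu

/-- The degree-`d` coefficient of the untwisted triad `M_ρ(a) M_ρ(b) M_ρ(c)`.
[cite: ConnerHuangLandsberg2020, §8] -/
theorem coeff_triad_untwist (ρ : Fin 17) (a b c : Fin 3 × Fin 3) (d : ℕ) :
    (u ρ a * u ρ b * u ρ c).coeff d =
      if (mEntry (chlTable ρ) a.1 a.2).2 + (mEntry (chlTable ρ) b.1 b.2).2 +
          (mEntry (chlTable ρ) c.1 c.2).2 = d then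
        ev (mEntry (chlTable ρ) a.1 a.2).1 * ev (mEntry (chlTable ρ) b.1 b.2).1 *
          ev (mEntry (chlTable ρ) c.1 c.2).1
      else 0 := by
  have hmul : u ρ a * u ρ b * u ρ c =
      C (ev (mEntry (chlTable ρ) a.1 a.2).1 * ev (mEntry (chlTable ρ) b.1 b.2).1 *
          ev (mEntry (chlTable ρ) c.1 c.2).1) *
        X ^ ((mEntry (chlTable ρ) a.1 a.2).2 + (mEntry (chlTable ρ) b.1 b.2).2 +
          (mEntry (chlTable ρ) c.1 c.2).2) := by
    simp only [hu, map_mul, pow_add]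
    ring
  rw [hmul, coeff_C_mul_X_pow]
  by_cases h : (mEntry (chlTable ρ) a.1 a.2).2 + (mEntry (chlTable ρ) b.1 b.2).2 +
      (mEntry (chlTable ρ) c.1 c.2).2 = d
  · rw [if_pos h.symm, if_pos h]
  · rw [if_neg (Ne.symm h), if_neg h]

/-- The twisted model term at `(a, b, γc)` evaluates to `σ` times the untwisted coefficient.
[cite: ConnerHuangLandsberg2020, §8] -/
theorem ev_termZ_gam (ρ : Fin 17) (a b c : Fin 3 × Fin 3) (d : ℕ) :
    ev (termZ ρ a.1 a.2 b.1 b.2 (gam c.1) (gam c.2) d) =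
      ((sgnB b.1 * sgnB b.2 * (sgnC (gam c.1) * sgnC (gam c.2)) : ℤ) : ℂ) *
        (u ρ a * u ρ b * u ρ c).coeff d := by
  rw [coeff_triad_untwist hu]
  simp only [termZ, triadOf, gam_gam]
  by_cases h : (mEntry (chlTable ρ) a.1 a.2).2 + (mEntry (chlTable ρ) b.1 b.2).2 +
      (mEntry (chlTable ρ) c.1 c.2).2 = d
  · rw [if_pos h, if_pos h]
    simp only [ev, Z12S.eval_mul zeta12_rel beta5_rel, Z12S.eval_smul]
    push_cast
    ring
  · rw [if_neg h, if_neg h]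
    simp [ev, Z12S.eval_zero]

/-- **The kernel-verified identity, untwisted**: for `d ≤ 15`, the degree-`d` coefficient of
`∑_s M_s ⊗ M_s ⊗ M_s` is `1000 · ε ⊗ ε` in degree `15` and `0` below.
[cite: ConnerHuangLandsberg2020, §8] -/
theorem sum_coeff_untwist (a b c : Fin 3 × Fin 3) {d : ℕ} (hd : d ≤ 15) :
    (∑ ρ, u ρ a * u ρ b * u ρ c).coeff d =
      if d = 15 then (1000 : ℂ) * det3Target ℂ a b c else 0 := by
  set σ : ℤ := sgnB b.1 * sgnB b.2 * (sgnC (gam c.1) * sgnC (gam c.2)) with hσ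
  have hσ2 : (σ : ℂ) * σ = 1 := by exact_mod_cast sign_sq b.1 b.2 c.1 c.2
  have key := congrArg ev (lhsZ_eq_rhsZ a.1 a.2 b.1 b.2 (gam c.1) (gam c.2) hd)
  rw [lhsZ, ev, Z12S.eval_sumList, List.map_ofFn, Fin.sum_ofFn] at key
  change (∑ ρ : Fin 17, ev (termZ ρ a.1 a.2 b.1 b.2 (gam c.1) (gam c.2) d)) = _ at key
  simp only [ev_termZ_gam hu, ← Finset.mul_sum] at key
  rw [finsetSum_coeff]
  calc ∑ ρ, (u ρ a * u ρ b * u ρ c).coeff d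
      = (σ : ℂ) * ((σ : ℂ) * ∑ ρ, (u ρ a * u ρ b * u ρ c).coeff d) := by
        rw [← mul_assoc, hσ2, one_mul]
    _ = (σ : ℂ) * ev (rhsZ a.1 a.2 b.1 b.2 (gam c.1) (gam c.2) d) := by rw [hσ, key]
    _ = if d = 15 then (1000 : ℂ) * det3Target ℂ a b c else 0 := by
        rw [rhsZ]
        split_ifs with h15
        · have e := sign_untwist a.1 a.2 b.1 b.2 c.1 c.2
          simp only [ev, Z12S.eval_ofInt, det3Target, hσ]
          rw [← e]
          push_cast
          ring
        · simp [ev, Z12S.eval_zero]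

/-- **CHL 2020, §8, as a symmetric approximate decomposition**:
`∑_{s=1}^{17} M_s ⊗ M_s ⊗ M_s = t¹⁵ · 1000 (ε ⊗ ε) + O(t¹⁶)` in `ℂ[t]`, i.e. (dividing by `1000 t¹⁵`,
`M_s = 10 t⁵ m_s`) the printed `det₃ = ∑_s m_s(t)^{⊗3} + O(t)`. [cite: ConnerHuangLandsberg2020, §8] -/
theorem isApproxDecomposition_untwist :
    IsApproxDecomposition 15 (fun a b c : Fin 3 × Fin 3 => (1000 : ℂ) * det3Target ℂ a b c)
      u u u :=
  fun a b c _ hd => sum_coeff_untwist hu a b c hd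

end Untwist

/-- **`1000 · ε ⊗ ε` has a symmetric order-`15` approximate decomposition with `17` vectors over
`ℂ[t]`** (the vectors `M_s = 10 t⁵ m_s(t)` of CHL 2020, §8). [cite: ConnerHuangLandsberg2020, §8] -/
theorem exists_isApproxDecomposition_det3Target :
    ∃ u : Fin 17 → Fin 3 × Fin 3 → ℂ[X],
      IsApproxDecomposition 15 (fun a b c : Fin 3 × Fin 3 => (1000 : ℂ) * det3Target ℂ a b c)
        u u u :=
  ⟨fun ρ a => C (ev (mEntry (chlTable ρ) a.1 a.2).1) * X ^ (mEntry (chlTable ρ) a.1 a.2).2,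
    isApproxDecomposition_untwist fun _ _ => rfl⟩

end CHL17

/-! ## The discharges -/

/-- `ε ⊗ ε` (the determinant tensor in the normalisation `det₃(X,X,X) = 6 det X`) is a limit of sums
of 17 cubes. [cite: ConnerHuangLandsberg2020, §8] -/
theorem det3Target_mem_closure_waringLESet :
    (fun a b c : Fin 3 × Fin 3 => det3Target ℂ a b c) ∈
      closure (waringLESet (Fin 3 × Fin 3) ℂ 17) := by
  obtain ⟨u, hu⟩ := CHL17.exists_isApproxDecomposition_det3Target
  have h := smul_mem_closure_waringLESet (1 / 1000 : ℂ)
    (mem_closure_waringLESet_of_isApproxDecomposition hu)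
  convert h using 1
  funext a b c
  simp only [Pi.smul_apply, smul_eq_mul]
  ring

/-- **CGLV Thm. 4.2, discharged: `bR_S(det₃) ≤ 17`** (the border Waring rank of the `3 × 3`
determinant as a symmetric tensor in `ℂ⁹ ⊗ ℂ⁹ ⊗ ℂ⁹`), by the kernel-verified Waring border rank 17
expression of CHL 2020, §8 (`det₃ = (1/6) ε ⊗ ε` and the closure of the sums of 17 cubes is a cone).
[cite: ConnerGesmundoLandsbergVentura2022, Thm. 4.2] -/
theorem CGLV2022_thm42_holds : CGLV2022_thm42 := by
  have hdet : det3Tensor ∈ closure (waringLESet (Fin 3 × Fin 3) ℂ 17) := by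
    rw [det3Tensor_eq_smul_det3Target]
    exact smul_mem_closure_waringLESet _ det3Target_mem_closure_waringLESet
  exact Nat.sInf_le hdet

/-- **CGLV Thm. 1.3, discharged: `R_S(det₃) ≤ 18` and `bR_S(det₃) ≤ 17`** (Thm. 4.1, proved in
`BorderRankCWProofs.lean`, and Thm. 4.2 above). [cite: ConnerGesmundoLandsbergVentura2022, Thm. 1.3] -/
theorem CGLV2022_thm13_holds : CGLV2022_thm13 :=
  CGLV2022_thm13_of_thm42 CGLV2022_thm42_holds

end Literature.Computability.AlgebraicComplexity

end
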